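import Summits.AtomisticToContinuum.HydrodynamicLimit.Theses.CollisionIsometryCLT
import Summits.AtomisticToContinuum.HydrodynamicLimit.Theorems.AprioriBounds.Negative.AdmissibleKernel
import Literature.Analysis.FluidPDE.HardSphereAlexander
import Literature.MathematicalPhysics.KineticTheory.HardSphereEulerProofs

/-!
# `FastMomentRelaxation` (stmt-AtomisticToContinuum-9522), negative knowledge 1: `0 < δ` is load-bearing

Load-bearing analysis of the crux `CollisionIsometryCLT.FastMomentRelaxation` (shared verbatim with
`StiffCollisionalRelaxation.FastMomentRelaxation`) by the standing disprover
(`Cruxes/FastMomentRelaxation/Disproof.lean`, refuter-cdisprove-stmt-AtomisticToContinuum-9522-0).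

The crux asserts, for `t > 0` and `δ > 0`, that the local-Gibbs probability of
`{z | δ < ∫₀ᵗ∫ₓ |D|² + |q|²}` tends to `0` (`D` = block traceless central kinetic stress, `q` = block central
kinetic heat flux of the evolved gas).  The observable is a double integral of a sum of squares, hence `≥ 0`
for EVERY configuration — including the Bochner-junk value `0` of a non-integrable section — so for `δ < 0`
the event is all of phase space, whose probability is `1` for every `N` as soon as `σ ≤ 1/2`
(`isProbabilityMeasure_localGibbsLaw`).  Hence the verbatim statement with `0 < δ` dropped is FALSE
(`fastMomentRelaxation_false_without_delta_pos`): the hypothesis is load-bearing, if only trivially, and no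
proof can avoid using the sign of `δ`.  Witness: homogeneous profile, `σ = min (σ₀/2) (1/4)`, Alexander's
flows, the torus-mollifier kernel family (`exists_admissibleKernelFamily`), `t = 1`, `δ = -1`.
All `[folklore]`.
-/

noncomputable section

open MeasureTheory Filter Set Topology Function
open scoped ENNReal Topology BigOperators

namespace Summit.AtomisticToContinuum.HydrodynamicLimit.Theorems

namespace FastMomentRelaxationNegative

open Literature.MathematicalPhysics.KineticTheory Literature.Analysis.FluidPDE
open AprioriBoundsNegative (exists_admissibleKernelFamily)

/-- A sequence in `ℝ≥0∞` that is constantly `1` does not tend to `0`. [folklore] -/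
theorem not_tendsto_zero_of_forall_eq_one {f : ℕ → ℝ≥0∞} (hf : ∀ N, f N = 1) :
    ¬ Tendsto f atTop (𝓝 0) := by
  intro h
  have hev : ∀ᶠ N in atTop, f N < 1 := h.eventually (gt_mem_nhds (by norm_num))
  obtain ⟨N, hN⟩ := hev.exists
  rw [hf N] at hN
  exact lt_irrefl _ hN

/-- **The crux `FastMomentRelaxation` with the hypothesis `0 < δ` DROPPED** (everything else verbatim:
profiles, `∃ σ₀ ∀ σ ∈ (0, σ₀)`, flow families, admissible kernel families with `0 < γ ≤ 1/15`, the block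
fields `ρ̄, m̄, ū = ρ̄⁻¹m̄`, the traceless central block stress `D`, the central block heat flux `q`, `∀ t > 0`,
and the conclusion `P(δ < ∫₀ᵗ∫ₓ Σ D² + |q|²) → 0` — now for EVERY real `δ`).  A negative-knowledge variant
(definition), not a cited fact and not a route item. -/
def FastMomentRelaxationWithoutDeltaPos : Prop :=
  ∀ (a₀ θ₀ : (UnitAddTorus (Fin 3)) → ℝ) (u₀ : (UnitAddTorus (Fin 3)) → (EuclideanSpace ℝ (Fin 3))), Continuous a₀ → Continuous θ₀ → Continuous u₀ → (∀ x, 0 < a₀ x) → (∀ x, 0 < θ₀ x) → ∃ σ₀ : ℝ, 0 < σ₀ ∧ ∀ σ : ℝ, 0 < σ → σ < σ₀ → ∀ Φ : (N : ℕ) → Literature.Analysis.FluidPDE.HardSphereFlow (Literature.Analysis.FluidPDE.Torus.geometry (Fin 3)) (Literature.MathematicalPhysics.KineticTheory.hsDiameter σ N) (N + 1), ∀ (γ C : ℝ) (φ : ℕ → (UnitAddTorus (Fin 3)) → ℝ), 0 < γ → γ ≤ 1 / 15 → ((∀ N, Literature.Analysis.FunctionSpaces.Torus.IsSmooth (φ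 N)) ∧ (∀ N y, 0 ≤ φ N y) ∧ (∀ N, ∫ y, φ N y = 1) ∧ (∀ (N : ℕ) y, ((N : ℝ) + 1) ^ (-γ) ≤ Literature.Analysis.FluidPDE.Torus.euclidDist y 0 → φ N y = 0) ∧ (∀ (N : ℕ) y, φ N y ≤ C * ((N : ℝ) + 1) ^ (3 * γ)) ∧ (∀ (N : ℕ) y, ‖Literature.Analysis.FunctionSpaces.Torus.gradient (φ N) y‖ ≤ C * ((N : ℝ) + 1) ^ (4 * γ))) → let ρb := fun (N : ℕ) (z : Literature.Analysis.FluidPDE.Config (N + 1) (Fin 3) (UnitAddTorus (Fin 3))) (x : (UnitAddTorus (Fin 3))) => Literature.MathematicalPhysics.KineticTheory.empiricalDensityField z (fun y => φ N (y - x)); let mb := fun (N : ℕ) (z : Literature.Analysis.FluidPDE.Config (N + 1) (Fin 3) (UnitAddTorus (Fin 3))) (x : (UnitAddTorus (Fin 3))) => Literature.MathematicalPhysics.KineticTheory.empiricalMomentumField z (fun y => φ N (y - x)); let ub := fun (N : ℕ) (z : Literature.Analysis.FluidPDE.Config (N + 1) (Fin 3) (UnitAddTorus (Fin 3))) (x :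 (UnitAddTorus (Fin 3))) => (ρb N z x)⁻¹ • mb N z x; let D := fun (N : ℕ) (z : Literature.Analysis.FluidPDE.Config (N + 1) (Fin 3) (UnitAddTorus (Fin 3))) (x : (UnitAddTorus (Fin 3))) (j k : Fin 3) => (∫ y, φ N (y.1 - x) * ((y.2 j - ub N z x j) * (y.2 k - ub N z x k)) ∂(Literature.Analysis.FluidPDE.empiricalMeasure z)) - (if j = k then (∑ l : Fin 3, ∫ y, φ N (y.1 - x) * (y.2 l - ub N z x l) ^ 2 ∂(Literature.Analysis.FluidPDE.empiricalMeasure z)) / 3 else 0); let q := fun (N : ℕ) (z : Literature.Analysis.FluidPDE.Config (N + 1) (Fin 3) (UnitAddTorus (Fin 3))) (x : (UnitAddTorus (Fin 3))) => ∫ y, (φ N (y.1 - x) * ‖y.2 - ub N z x‖ ^ 2 / 2) • (y.2 - ub N z x) ∂(Literature.Analysis.FluidPDE.empiricalMeasure z); ∀ t : ℝ, 0 < t → ∀ δ : ℝ, Tendsto (fun N : ℕ => Literature.MathematicalPhysics.KineticTheory.localGibbsLaw σ a₀ u₀ θ₀ N (Φ N) {z | δ < ∫ s in Icc 0 t, ∫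 x, ((∑ j, ∑ k, D N ((Φ N).flow s z) x j k ^ 2) + ‖q N ((Φ N).flow s z) x‖ ^ 2)}) atTop (𝓝 0)

/-- **`0 < δ` is load-bearing.**  Witness: homogeneous profile `a₀ = θ₀ = 1, u₀ = 0`; given `σ₀`, take
`σ = min (σ₀/2) (1/4)`, Alexander's flows (`hsDiameter σ N ≤ σ < 1/2`), the torus-mollifier kernel family,
`t = 1`, `δ = -1`: the observable `∫₀ᵗ∫ₓ |D|² + |q|²` is `≥ 0` (also when Bochner-junk), so the event is ALL of
phase space and has probability `1` for every `N` (the local Gibbs laws are probability measures for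
`σ ≤ 1/2`). [folklore] -/
theorem fastMomentRelaxation_false_without_delta_pos : ¬ FastMomentRelaxationWithoutDeltaPos := by
  intro h
  obtain ⟨σ₀, hσ₀, h⟩ := h (fun _ => 1) (fun _ => 1) (fun _ => 0) continuous_const continuous_const
    continuous_const (fun _ => one_pos) (fun _ => one_pos)
  set σ : ℝ := min (σ₀ / 2) (1 / 4) with hσdef
  have hσ : 0 < σ := lt_min (by linarith) (by norm_num)
  have hσlt : σ < σ₀ := lt_of_le_of_lt (min_le_left _ _) (by linarith)
  have hσ4 : σ ≤ 1 / 4 := min_le_right _ _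
  have hσ2 : σ ≤ 1 / 2 := hσ4.trans (by norm_num)
  have hεlt : ∀ N : ℕ, hsDiameter σ N < 2⁻¹ := fun N =>
    lt_of_le_of_lt (hsDiameter_le hσ.le N) (by linarith)
  set Φ : (N : ℕ) → HardSphereFlow (Torus.geometry (Fin 3)) (hsDiameter σ N) (N + 1) :=
    fun N => (HardSphereFlow.nonempty_torus_holds (hsDiameter_pos hσ N) (hεlt N) (N + 1)).some with hΦ
  obtain ⟨γ, C, φ, hγ, hγ', hsm, hnn, hone, hsupp, hsup, hgrad, -⟩ := exists_admissibleKernelFamily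
  have hT := h σ hσ hσlt Φ γ C φ hγ hγ' ⟨hsm, hnn, hone, hsupp, hsup, hgrad⟩ 1 one_pos (-1)
  refine absurd hT (not_tendsto_zero_of_forall_eq_one fun N => ?_)
  haveI : IsProbabilityMeasure (localGibbsLaw σ (fun _ => 1) (fun _ => 0) (fun _ => 1) N (Φ N)) :=
    isProbabilityMeasure_localGibbsLaw continuous_const continuous_const continuous_const
      (fun _ => one_pos) (fun _ => one_pos) hσ2 N (Φ N)
  dsimp only
  rw [← measure_univ (μ := localGibbsLaw σ (fun _ => 1) (fun _ => 0) (fun _ => 1) N (Φ N))]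
  congr 1
  refine eq_univ_of_forall fun z => ?_
  simp only [mem_setOf_eq]
  refine lt_of_lt_of_le (by norm_num) (integral_nonneg fun s => integral_nonneg fun x => ?_)
  positivity

end FastMomentRelaxationNegative

end Summit.AtomisticToContinuum.HydrodynamicLimit.Theorems

end
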